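import Summits.BirchSwinnertonDyer.BirchSwinnertonDyer.Theorems.PrintCf2RubinValueTwoLeopoldtAtV
import Literature.NumberTheory.Transcendental.BrumerPadicBakerProofs
import HarnessLib

/-!
# The `𝔭`-adic Leopoldt theorem, family form: `𝓞_Fˣ/tors ⊗ ℚ̄_p → ℚ̄_p^{Gal(F/K)}` is injective

Support file 7 of the brick «(b) weak Leopoldt over `𝔎_∞`: `Ē_∞ ↪ U_v`» (cell bsd-print-cf2, LEAD
ruling B23 §4 (b)) for crux `PrintCf2RubinValueTwo.TwoVariableMainConjAtSplitTwo`
(stmt-BirchSwinnertonDyer-23720). Namespace `…Theorems.PrintCf2.LeopoldtAtV`.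

`LeopoldtAtV.linearIndependent_padicLog_fundSystem` states the `𝔭`-adic Leopoldt theorem (de Shalit
1987 III.2.3, Baker–Brumer) for Mathlib's fundamental system of units. Here is the basis-free form a
consumer of «`Ē ↪ U_v`» wants: for `K` imaginary quadratic, `F/K` finite abelian, `τ : F →+* ℚ̄_p`
and ANY family of units `u_j ∈ 𝓞_Fˣ` which is `ℤ`-linearly independent (in `𝓞_Fˣ` written
additively; equivalently, modulo torsion), the vectors `Λ(u_j) = (log_p τ(σ u_j))_{σ ∈ Gal(F/K)}` are
`ℚ̄_p`-linearly independent — the `ℚ̄_p`-linear extension of `Λ` to `(𝓞_Fˣ/tors) ⊗ ℚ̄_p` is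
injective (a fortiori `𝓞_Fˣ ⊗ ℤ_p → ∏_{w∣v} U_w` is).

* `padicLog_units_eq_sum_of_eq_mul_prod` — `Λ(ζ · ∏ᵢ fᵢ^{eᵢ}) = ∑ᵢ eᵢ • Λ(fᵢ)` for `ζ` torsion and the
  fundamental units `fᵢ` (`Λ` is additive and kills roots of unity);
* `linearIndependent_padicLog_of_linearIndependent` (granted `hB : brumer1967_thm1 p`) and
  `…_holds` (unconditional, via the tree's `brumer1967_thm1_holds`).

References: E. de Shalit (1987) III.2.3; A. Brumer, Mathematika 14 (1967) Thm. 1; L. C. Washington,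
GTM 83, Thm. 5.25 and §5.5.
-/

noncomputable section

set_option linter.dupNamespace false -- `Summit.BirchSwinnertonDyer.BirchSwinnertonDyer` (summit = problem) is the tree's layout
set_option autoImplicit false

open NumberField Module Submodule
open Literature.NumberTheory.EllipticCurves Literature.NumberTheory.Transcendental

namespace Summit.BirchSwinnertonDyer.BirchSwinnertonDyer.Theorems.PrintCf2.LeopoldtAtV

variable {p : ℕ} [Fact p.Prime]
variable {K : Type} [Field K] [NumberField K] {F : Type} [Field F] [NumberField F] [Algebra K F]

omit [NumberField K] in
/-- **`Λ` in coordinates**: if `u = ζ · ∏ᵢ fᵢ^{eᵢ}` with `ζ` a root of unity and `fᵢ = fundSystem F i`,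
then `Λ(u) = ∑ᵢ eᵢ • Λ(fᵢ)` (`Λ(u) = (log_p τ(σu))_σ` is additive and kills torsion).
[cite: Washington1997, §5.5] -/
theorem padicLog_units_eq_sum_of_eq_mul_prod (τ : F →+* PadicAlgCl p) {u ζ : (𝓞 F)ˣ}
    (hζ : ζ ∈ Units.torsion F) {e : Fin (Units.rank F) → ℤ}
    (hu : u = ζ * ∏ i, Units.fundSystem F i ^ e i) :
    (fun σ : F ≃ₐ[K] F ↦ padicLogAlgCl p (τ (σ (algebraMap (𝓞 F) F (u : 𝓞 F))))) =
      ∑ i : Fin (Units.rank F), ((e i : ℤ) : PadicAlgCl p) •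
        (fun σ : F ≃ₐ[K] F ↦
          padicLogAlgCl p (τ (σ (algebraMap (𝓞 F) F (Units.fundSystem F i : 𝓞 F))))) := by
  classical
  have hlog := padicLogAlgCl_isIwasawaLog_holds p
  have hne : ∀ (v : (𝓞 F)ˣ) (σ : F ≃ₐ[K] F), τ (σ (algebraMap (𝓞 F) F (v : 𝓞 F))) ≠ 0 :=
    fun v σ ↦ by
      rw [Ne, map_eq_zero_iff τ τ.injective, map_eq_zero_iff σ σ.injective,
        map_eq_zero_iff _ (IsFractionRing.injective (𝓞 F) F)]
      exact v.ne_zero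
  let Λ : (𝓞 F)ˣ →* Multiplicative ((F ≃ₐ[K] F) → PadicAlgCl p) :=
    { toFun := fun v ↦ Multiplicative.ofAdd fun σ : F ≃ₐ[K] F ↦
        padicLogAlgCl p (τ (σ (algebraMap (𝓞 F) F (v : 𝓞 F))))
      map_one' := by
        rw [← ofAdd_zero]
        congr 1
        funext σ
        simp [hlog.log_one]
      map_mul' := fun v w ↦ by
        rw [← ofAdd_add]
        congr 1
        funext σ
        simp only [Units.val_mul, map_mul, Pi.add_apply]
        exact hlog.2.2.1 _ _ (hne v σ) (hne w σ) }
  have hΛ : ∀ v : (𝓞 F)ˣ, (fun σ : F ≃ₐ[K] F ↦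
      padicLogAlgCl p (τ (σ (algebraMap (𝓞 F) F (v : 𝓞 F))))) = Multiplicative.toAdd (Λ v) :=
    fun v ↦ rfl
  have hζ0 : Multiplicative.toAdd (Λ ζ) = 0 := by
    funext σ
    change padicLogAlgCl p ((τ.comp (σ : F ≃ₐ[K] F).toRingEquiv.toRingHom)
      (algebraMap (𝓞 F) F ((ζ : (𝓞 F)ˣ) : 𝓞 F))) = 0
    exact (padicLogAlgCl_embedding_unit_eq_zero_iff _ _).mpr hζ
  rw [hΛ u, hu, map_mul, toAdd_mul, hζ0, zero_add, map_prod, toAdd_prod]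
  refine Finset.sum_congr rfl fun i _ ↦ ?_
  rw [map_zpow, toAdd_zpow, Int.cast_smul_eq_zsmul]
  rfl

omit [NumberField K] [NumberField F] [Algebra K F] in
/-- `∏_{i ∈ s} a ^ f i = a ^ ∑_{i ∈ s} f i` for integer exponents in a commutative group. [folklore] -/
theorem prod_zpow_eq_zpow_sum {G : Type*} [CommGroup G] {ι : Type*} (s : Finset ι) (f : ι → ℤ)
    (a : G) : ∏ i ∈ s, a ^ f i = a ^ ∑ i ∈ s, f i := by
  classical
  induction s using Finset.induction_on with
  | empty => simp
  | insert j s hj ih => rw [Finset.prod_insert hj, Finset.sum_insert hj, zpow_add, ih]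

/-- **The `𝔭`-adic Leopoldt theorem, family form (granted Brumer).** `K` imaginary quadratic, `F/K`
finite abelian, `τ : F →+* ℚ̄_p` any embedding (any prime `p`): if the units `u_j ∈ 𝓞_Fˣ` are
`ℤ`-linearly independent (additively, in `𝓞_Fˣ`; equivalently modulo torsion), the vectors
`(log_p τ(σ u_j))_{σ ∈ Gal(F/K)}` are `ℚ̄_p`-linearly independent.
[cite: deShalit1987, III.2.3 (Theorem (Baker–Brumer))] [cite: Washington1997, Thm. 5.25] -/
theorem linearIndependent_padicLog_of_linearIndependent (hB : brumer1967_thm1 p)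
    (hK : IsImaginaryQuadratic K) [IsAbelianGalois K F] (τ : F →+* PadicAlgCl p)
    {ι : Type*} (u : ι → (𝓞 F)ˣ) (hu : LinearIndependent ℤ (fun j ↦ Additive.ofMul (u j))) :
    LinearIndependent (PadicAlgCl p) (fun j ↦ fun σ : F ≃ₐ[K] F ↦
      padicLogAlgCl p (τ (σ (algebraMap (𝓞 F) F (u j : 𝓞 F))))) := by
  classical
  -- coordinates: `u j = ζ j * ∏ fundSystem i ^ e j i`
  choose ζe hζe _ using fun j ↦ Units.exist_unique_eq_mul_prod F (u j)
  set e : ι → (Fin (Units.rank F) → ℤ) := fun j ↦ (ζe j).2 with he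
  have hcoord : ∀ j, (fun σ : F ≃ₐ[K] F ↦ padicLogAlgCl p (τ (σ (algebraMap (𝓞 F) F (u j : 𝓞 F)))))
      = ∑ i : Fin (Units.rank F), ((e j i : ℤ) : PadicAlgCl p) • (fun σ : F ≃ₐ[K] F ↦
          padicLogAlgCl p (τ (σ (algebraMap (𝓞 F) F (Units.fundSystem F i : 𝓞 F))))) :=
    fun j ↦ padicLog_units_eq_sum_of_eq_mul_prod τ (ζe j).1.2 (hζe j)
  -- the integer vectors `e j` are `ℤ`-independent
  have heZ : LinearIndependent ℤ e := by
    rw [linearIndependent_iff']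
    intro s n hn j hj
    -- `∏_{j ∈ s} (u j)^(n j)` is torsion
    have hprod : ∏ j ∈ s, u j ^ n j = ∏ j ∈ s, ((ζe j).1 : (𝓞 F)ˣ) ^ n j := by
      have h1 : ∀ j ∈ s, u j ^ n j =
          ((ζe j).1 : (𝓞 F)ˣ) ^ n j * ∏ i, Units.fundSystem F i ^ (e j i * n j) := by
        intro j _
        conv_lhs => rw [hζe j]
        rw [mul_zpow, ← Finset.prod_zpow]
        refine congrArg _ (Finset.prod_congr rfl fun i _ ↦ ?_)
        rw [← zpow_mul]
      rw [Finset.prod_congr rfl h1, Finset.prod_mul_distrib, Finset.prod_comm]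
      have h2 : ∏ i : Fin (Units.rank F), ∏ j ∈ s, Units.fundSystem F i ^ (e j i * n j) = 1 := by
        refine Finset.prod_eq_one fun i _ ↦ ?_
        rw [prod_zpow_eq_zpow_sum]
        have : ∑ j ∈ s, e j i * n j = 0 := by
          have := congr_fun hn i
          simpa [Finset.sum_apply, Pi.smul_apply, smul_eq_mul, mul_comm] using this
        rw [this, zpow_zero]
      rw [h2, mul_one]
    have htors : (∏ j ∈ s, u j ^ n j) ∈ Units.torsion F := by
      rw [hprod]
      exact Subgroup.prod_mem _ fun j _ ↦ Subgroup.zpow_mem _ (ζe j).1.2 _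
    rw [Units.torsion, CommGroup.mem_torsion, isOfFinOrder_iff_pow_eq_one] at htors
    obtain ⟨k, hk, hk1⟩ := htors
    -- so `∑ (k * n j) • u j = 0` additively, hence `k * n j = 0`
    have hrel : ∑ j ∈ s, ((k : ℤ) * n j) • Additive.ofMul (u j) = 0 := by
      have h1 : ∏ j ∈ s, u j ^ ((k : ℤ) * n j) = 1 := by
        have h1' : ∏ j ∈ s, u j ^ ((k : ℤ) * n j) = (∏ j ∈ s, u j ^ n j) ^ (k : ℤ) := by
          rw [← Finset.prod_zpow]
          exact Finset.prod_congr rfl fun j _ ↦ by rw [mul_comm, zpow_mul]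
        rw [h1', zpow_natCast, hk1]
      have h2 := congrArg Additive.ofMul h1
      rw [ofMul_prod, ofMul_one] at h2
      simpa only [ofMul_zpow] using h2
    have h0 := (linearIndependent_iff'.mp hu) s (fun j ↦ (k : ℤ) * n j) hrel j hj
    have hk0 : (k : ℤ) ≠ 0 := by exact_mod_cast hk.ne'
    exact (mul_eq_zero.mp h0).resolve_left hk0
  -- base change to `ℚ̄_p`
  have heL : LinearIndependent (PadicAlgCl p) (fun j ↦ algebraMap ℤ (PadicAlgCl p) ∘ e j) :=
    linearIndependent_algebraMap_comp_iff.mpr heZ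
  -- the injective linear map `x ↦ ∑ xᵢ • Λ(fundSystem i)`
  set v : Fin (Units.rank F) → ((F ≃ₐ[K] F) → PadicAlgCl p) := fun i σ ↦
    padicLogAlgCl p (τ (σ (algebraMap (𝓞 F) F (Units.fundSystem F i : 𝓞 F)))) with hv
  have hvli : LinearIndependent (PadicAlgCl p) v := linearIndependent_padicLog_fundSystem hB hK τ
  have hker : LinearMap.ker (Fintype.linearCombination (PadicAlgCl p) v) = ⊥ :=
    LinearMap.ker_eq_bot.mpr hvli.fintypeLinearCombination_injective
  have h := heL.map' _ hker
  have hfun : (fun j ↦ fun σ : F ≃ₐ[K] F ↦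
      padicLogAlgCl p (τ (σ (algebraMap (𝓞 F) F (u j : 𝓞 F))))) =
      (⇑(Fintype.linearCombination (PadicAlgCl p) v) ∘ fun j ↦ algebraMap ℤ (PadicAlgCl p) ∘ e j) := by
    funext j
    rw [Function.comp_apply, Fintype.linearCombination_apply, hcoord j]
    refine Finset.sum_congr rfl fun i _ ↦ ?_
    simp [hv]
  rw [hfun]
  exact h

/-- **The `𝔭`-adic Leopoldt theorem, family form, UNCONDITIONAL** (Brumer discharged by the tree's
`brumer1967_thm1_holds`): `K` imaginary quadratic, `F/K` finite abelian, any `p`, any `τ`;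
`ℤ`-independent units have `ℚ̄_p`-independent `𝔭`-adic logarithm vectors — `Ē ↪ U_v` at the
finite layer `F`. [cite: deShalit1987, III.2.3 (Theorem (Baker–Brumer))] [cite: Brumer1967, Thm. 1] -/
theorem linearIndependent_padicLog_of_linearIndependent_holds (hK : IsImaginaryQuadratic K)
    [IsAbelianGalois K F] (τ : F →+* PadicAlgCl p) {ι : Type*} (u : ι → (𝓞 F)ˣ)
    (hu : LinearIndependent ℤ (fun j ↦ Additive.ofMul (u j))) :
    LinearIndependent (PadicAlgCl p) (fun j ↦ fun σ : F ≃ₐ[K] F ↦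
      padicLogAlgCl p (τ (σ (algebraMap (𝓞 F) F (u j : 𝓞 F))))) :=
  linearIndependent_padicLog_of_linearIndependent (brumer1967_thm1_holds p) hK τ u hu

end Summit.BirchSwinnertonDyer.BirchSwinnertonDyer.Theorems.PrintCf2.LeopoldtAtV

end
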